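import Literature.Analysis.OperatorTheory.EigenbasisSpectralProjection
import HarnessLib

/-!
# Measurability of the spectral calculus along a measurable family of compact self-adjoint
# operators given with eigenbases

Topic `Literature/Analysis/OperatorTheory`. Setting: a measurable space `X` (frequencies), a
Hilbert space `H`, and for every `ξ ∈ X` a Hilbert basis `e ξ` of `H` (index type `ι ξ` depending
on `ξ`) with real levels `κ ξ i ∈ [0, 1]` — the eigen-decomposition of the operator
`K ξ = diag_{e ξ}(κ ξ)` (a resolvent). The eigenbases are chosen *arbitrarily* for each `ξ`; the
only link between different `ξ` is the hypothesis that `ξ ↦ K ξ` is strongly measurable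
(operator norm). We prove that the **spectral calculus is then measurable**: for every measurable
`S ⊆ X × ℝ` and every strongly measurable `v : X → H`,

  `ξ ↦ 1_S(ξ, K ξ) v ξ := Σ_i 1_S(ξ, κ ξ i) ⟨e ξ i, v ξ⟩ e ξ i`

is strongly measurable (`stronglyMeasurable_diagIndicator`). This is the measurability needed to
define frequency-localised pieces `Π_{𝒞}(ξ) û(ξ)` of an `L²(ℝ_ξ; H)` function by cells `𝒞` in the
joint (frequency, eigenvalue) space (Dafermos–Rodnianski–Shlapentokh-Rothman, arXiv:1402.7034,
§13.1.3, Def. 13.1.2: "trapped frequencies" cells), independently of how eigenbases are chosen.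

Route (Reed–Simon I §VII.1–VII.2, functional calculus, made measurable): powers `K^n` are
continuous in `K` ⇒ polynomials `p(K ξ) v ξ` measurable (`diag_eval_eq_sum`); Weierstrass ⇒
continuous functions of the levels (`stronglyMeasurable_diag_continuous`); thickened indicators ⇒
closed level sets times measurable `ξ`-sets; Dynkin `π`–`λ` twice (in the level variable, then
in the product) using dominated convergence in the eigen-sum (`tendsto_diag_of_tendsto`).

## References

* M. Reed, B. Simon, *Methods of Modern Mathematical Physics I* (1980), §VII.1, Thm. VII.2.
  [ReedSimonI1980]
* M. Dafermos, I. Rodnianski, Y. Shlapentokh-Rothman, arXiv:1402.7034, §13.1.3.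
  [DafermosRodnianskiShlapentokhrothman2014]
-/

noncomputable section

open Filter Topology Set MeasureTheory ContinuousLinearMap
open scoped InnerProductSpace ComplexConjugate ENNReal

namespace Literature.Analysis.OperatorTheory

variable {𝕜 : Type*} [RCLike 𝕜]
variable {H : Type*} [NormedAddCommGroup H] [InnerProductSpace 𝕜 H]

/-! ### More algebra of diagonal operators -/

section Algebra

variable {ι : Type*} {e : HilbertBasis ι 𝕜 H}
variable {r s : ι → 𝕜} {C C' : ℝ} {hr : ∀ i, ‖r i‖ ≤ C} {hs : ∀ i, ‖s i‖ ≤ C'}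

/-- The diagonal operator depends only on the entries (not on the bound). [folklore] -/
theorem diag_congr (h : ∀ i, r i = s i) (x : H) : basisDiag e r C hr x = basisDiag e s C' hs x := by
  refine e.ext_inner fun i ↦ ?_
  rw [inner_basis_diag, inner_basis_diag, h i]

/-- `diag 1 = id`. [folklore] -/
theorem diag_one (x : H) : basisDiag e (fun _ ↦ (1 : 𝕜)) 1 (fun _ ↦ by simp) x = x := by
  refine e.ext_inner fun i ↦ ?_
  rw [inner_basis_diag, one_mul]

/-- `diag r x + diag s x = diag (r + s) x`. [folklore] -/
theorem diag_add_diag (x : H) : basisDiag e r C hr x + basisDiag e s C' hs x =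
    basisDiag e (fun i ↦ r i + s i) (C + C')
      (fun i ↦ (norm_add_le _ _).trans (add_le_add (hr i) (hs i))) x := by
  refine e.ext_inner fun i ↦ ?_
  rw [inner_add_right, inner_basis_diag, inner_basis_diag, inner_basis_diag, add_mul]

/-- `a • diag r x = diag (a r) x`. [folklore] -/
theorem smul_diag (a : 𝕜) (x : H) : a • basisDiag e r C hr x =
    basisDiag e (fun i ↦ a * r i) (‖a‖ * C)
      (fun i ↦ by rw [norm_mul]; exact mul_le_mul_of_nonneg_left (hr i) (norm_nonneg _)) x := by
  refine e.ext_inner fun i ↦ ?_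
  rw [inner_smul_right, inner_basis_diag, inner_basis_diag, mul_assoc]

/-- Powers of entries of norm `≤ 1`. [folklore] -/
theorem norm_pow_le_one_of_le {κ : ι → 𝕜} (hκ : ∀ i, ‖κ i‖ ≤ 1) (n : ℕ) (i : ι) :
    ‖κ i ^ n‖ ≤ 1 := by
  rw [norm_pow]; exact pow_le_one₀ (norm_nonneg _) (hκ i)

/-- **Powers are diagonal**: `(diag κ)^n x = diag (κ^n) x`. [cite: ReedSimonI1980, Thm. VII.2] -/
theorem diag_pow_apply {κ : ι → 𝕜} (hκ : ∀ i, ‖κ i‖ ≤ 1) (n : ℕ) (x : H) :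
    (basisDiag e κ 1 hκ ^ n) x =
      basisDiag e (fun i ↦ κ i ^ n) 1 (norm_pow_le_one_of_le hκ n) x := by
  induction n generalizing x with
  | zero =>
    rw [pow_zero]
    change x = _
    refine e.ext_inner fun i ↦ ?_
    rw [inner_basis_diag, pow_zero, one_mul]
  | succ n ih =>
    rw [pow_succ]
    change (basisDiag e κ 1 hκ ^ n) (basisDiag e κ 1 hκ x) = _
    rw [ih, diag_diag]
    exact diag_congr (fun i ↦ by ring) x

/-- **Polynomials are diagonal**: `diag (p ∘ κ) x = Σ_k p_k (diag κ)^k x` for a real polynomial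
`p`. [cite: ReedSimonI1980, Thm. VII.2] -/
theorem diag_eval_eq_sum {κ : ι → ℝ} (hκ : ∀ i, ‖(κ i : 𝕜)‖ ≤ 1) (p : Polynomial ℝ) {Cp : ℝ}
    (hp : ∀ i, ‖((p.eval (κ i) : ℝ) : 𝕜)‖ ≤ Cp) (x : H) :
    basisDiag e (fun i ↦ ((p.eval (κ i) : ℝ) : 𝕜)) Cp hp x =
      ∑ k ∈ Finset.range (p.natDegree + 1),
        ((p.coeff k : ℝ) : 𝕜) • (basisDiag e (fun i ↦ (κ i : 𝕜)) 1 hκ ^ k) x := by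
  refine e.ext_inner fun i ↦ ?_
  rw [inner_basis_diag, inner_sum]
  simp_rw [inner_smul_right, diag_pow_apply, inner_basis_diag]
  rw [Polynomial.eval_eq_sum_range]
  push_cast
  rw [Finset.sum_mul]
  refine Finset.sum_congr rfl fun k _ ↦ ?_
  ring

end Algebra

/-! ### Indicator bounds -/

/-- Indicator bound. [folklore] -/
theorem abs_indicator_one_le {α : Type*} (S : Set α) (z : α) :
    |S.indicator (fun _ ↦ (1 : ℝ)) z| ≤ 1 := by
  classical
  rw [Set.indicator_apply]; split_ifs <;> simp

/-- Bound for indicator-type products. [folklore] -/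
theorem abs_indicator_mul_le {α : Type*} {A : Set α} {f : ℝ → ℝ} (hf : ∀ t, |f t| ≤ 1) (ξ : α)
    (t : ℝ) : |A.indicator (fun _ ↦ (1 : ℝ)) ξ * f t| ≤ 1 := by
  rw [abs_mul]
  exact mul_le_one₀ (abs_indicator_one_le A ξ) (abs_nonneg _) (hf t)

/-! ### The measurable setting -/

section Measurable

variable {X : Type*} {ι : X → Type*}

/-- Levels in `[0, 1]` have norm `≤ 1`. [folklore] -/
theorem norm_level_le_one (κ : ∀ ξ, ι ξ → ℝ) (hκ : ∀ ξ i, κ ξ i ∈ Icc (0 : ℝ) 1) (ξ : X) (i : ι ξ) :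
    ‖(κ ξ i : 𝕜)‖ ≤ 1 := by
  rw [RCLike.norm_ofReal, abs_le]; exact ⟨by linarith [(hκ ξ i).1], (hκ ξ i).2⟩

variable (e : ∀ ξ, HilbertBasis (ι ξ) 𝕜 H) (κ : ∀ ξ, ι ξ → ℝ)

/-- **The operator family `K ξ = diag_{e ξ}(κ ξ)`.** [folklore] -/
def diagFamily (hκ : ∀ ξ i, κ ξ i ∈ Icc (0 : ℝ) 1) (ξ : X) : H →L[𝕜] H :=
  basisDiag (e ξ) (fun i ↦ (κ ξ i : 𝕜)) 1 (norm_level_le_one κ hκ ξ)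

/-- **The eigen-calculus of a family of bounded functions of the levels**:
`diagCalc g ξ = diag_{e ξ}(g ξ ∘ κ ξ)` (bound `C` on `[0,1]`). [cite: ReedSimonI1980, §VII.1] -/
def diagCalc (hκ : ∀ ξ i, κ ξ i ∈ Icc (0 : ℝ) 1) (g : X → ℝ → ℝ) (C : ℝ)
    (hg : ∀ ξ, ∀ t ∈ Icc (0 : ℝ) 1, |g ξ t| ≤ C) (ξ : X) : H →L[𝕜] H :=
  basisDiag (e ξ) (fun i ↦ ((g ξ (κ ξ i) : ℝ) : 𝕜)) C
    (fun i ↦ by rw [RCLike.norm_ofReal]; exact hg ξ _ (hκ ξ i))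

variable {e κ} {hκ : ∀ ξ i, κ ξ i ∈ Icc (0 : ℝ) 1}

/-- Coefficients of the calculus. [folklore] -/
theorem inner_basis_diagCalc {g : X → ℝ → ℝ} {C : ℝ} {hg : ∀ ξ, ∀ t ∈ Icc (0 : ℝ) 1, |g ξ t| ≤ C}
    (ξ : X) (x : H) (i : ι ξ) :
    ⟪e ξ i, diagCalc e κ hκ g C hg ξ x⟫_𝕜 = ((g ξ (κ ξ i) : ℝ) : 𝕜) * ⟪e ξ i, x⟫_𝕜 :=
  inner_basis_diag x i

/-- The calculus depends only on the values of `g ξ` on `[0, 1]` (and not on the bound).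
[folklore] -/
theorem diagCalc_congr {g g' : X → ℝ → ℝ} {C C' : ℝ} {hg : ∀ ξ, ∀ t ∈ Icc (0 : ℝ) 1, |g ξ t| ≤ C}
    {hg' : ∀ ξ, ∀ t ∈ Icc (0 : ℝ) 1, |g' ξ t| ≤ C'} (ξ : X)
    (h : ∀ t ∈ Icc (0 : ℝ) 1, g ξ t = g' ξ t) (x : H) :
    diagCalc e κ hκ g C hg ξ x = diagCalc e κ hκ g' C' hg' ξ x :=
  diag_congr (fun i ↦ by rw [h _ (hκ ξ i)]) x

variable [MeasurableSpace X]

/-- The measurability property of a family of functions `g`. [folklore] -/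
def DiagMeasurable (e : ∀ ξ, HilbertBasis (ι ξ) 𝕜 H) (κ : ∀ ξ, ι ξ → ℝ)
    (hκ : ∀ ξ i, κ ξ i ∈ Icc (0 : ℝ) 1) (v : X → H) (g : X → ℝ → ℝ) : Prop :=
  ∀ (C : ℝ) (hg : ∀ ξ, ∀ t ∈ Icc (0 : ℝ) 1, |g ξ t| ≤ C),
    StronglyMeasurable fun ξ ↦ diagCalc e κ hκ g C hg ξ (v ξ)

variable {v : X → H}

/-- It suffices to check measurability for one bound. [folklore] -/
theorem diagMeasurable_of_one {g : X → ℝ → ℝ} (C : ℝ) (hg : ∀ ξ, ∀ t ∈ Icc (0 : ℝ) 1, |g ξ t| ≤ C)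
    (h : StronglyMeasurable fun ξ ↦ diagCalc e κ hκ g C hg ξ (v ξ)) :
    DiagMeasurable e κ hκ v g := by
  intro C' hg'
  have hfun : (fun ξ ↦ diagCalc e κ hκ g C' hg' ξ (v ξ)) = fun ξ ↦ diagCalc e κ hκ g C hg ξ (v ξ) :=
    funext fun ξ ↦ diagCalc_congr ξ (fun _ _ ↦ rfl) _
  rwa [hfun]

/-- Congruence of the property along equality on `[0, 1]`. [folklore] -/
theorem DiagMeasurable.congr {g g' : X → ℝ → ℝ} (h : DiagMeasurable e κ hκ v g)
    (hgg' : ∀ ξ, ∀ t ∈ Icc (0 : ℝ) 1, g ξ t = g' ξ t) {C' : ℝ}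
    (hg' : ∀ ξ, ∀ t ∈ Icc (0 : ℝ) 1, |g' ξ t| ≤ C') : DiagMeasurable e κ hκ v g' := by
  refine diagMeasurable_of_one C' hg' ?_
  have hg : ∀ ξ, ∀ t ∈ Icc (0 : ℝ) 1, |g ξ t| ≤ C' := fun ξ t ht ↦ by
    rw [hgg' ξ t ht]; exact hg' ξ t ht
  have hfun : (fun ξ ↦ diagCalc e κ hκ g' C' hg' ξ (v ξ)) =
      fun ξ ↦ diagCalc e κ hκ g C' hg ξ (v ξ) :=
    funext fun ξ ↦ (diagCalc_congr ξ (hgg' ξ) _).symm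
  rw [hfun]
  exact h C' hg

/-! #### Closure properties -/

/-- Sums. [folklore] -/
theorem DiagMeasurable.add {g g' : X → ℝ → ℝ} (h : DiagMeasurable e κ hκ v g)
    (h' : DiagMeasurable e κ hκ v g') {C C' : ℝ} (hg : ∀ ξ, ∀ t ∈ Icc (0 : ℝ) 1, |g ξ t| ≤ C)
    (hg' : ∀ ξ, ∀ t ∈ Icc (0 : ℝ) 1, |g' ξ t| ≤ C') :
    DiagMeasurable e κ hκ v fun ξ t ↦ g ξ t + g' ξ t := by
  have hb : ∀ ξ, ∀ t ∈ Icc (0 : ℝ) 1, |g ξ t + g' ξ t| ≤ C + C' := fun ξ t ht ↦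
    (abs_add_le _ _).trans (add_le_add (hg ξ t ht) (hg' ξ t ht))
  refine diagMeasurable_of_one (C + C') hb ?_
  have hfun : (fun ξ ↦ diagCalc e κ hκ (fun ξ t ↦ g ξ t + g' ξ t) (C + C') hb ξ (v ξ)) =
      fun ξ ↦ diagCalc e κ hκ g C hg ξ (v ξ) + diagCalc e κ hκ g' C' hg' ξ (v ξ) := by
    funext ξ
    refine (e ξ).ext_inner fun i ↦ ?_
    rw [inner_add_right, inner_basis_diagCalc, inner_basis_diagCalc, inner_basis_diagCalc]
    push_cast
    ring
  rw [hfun]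
  exact (h C hg).add (h' C' hg')

/-- Scalar multiples by bounded measurable functions of `ξ`. [folklore] -/
theorem DiagMeasurable.mul_left {g : X → ℝ → ℝ} (h : DiagMeasurable e κ hκ v g) {a : X → ℝ}
    (ha : Measurable a) {A : ℝ} (hab : ∀ ξ, |a ξ| ≤ A) {C : ℝ}
    (hg : ∀ ξ, ∀ t ∈ Icc (0 : ℝ) 1, |g ξ t| ≤ C) :
    DiagMeasurable e κ hκ v fun ξ t ↦ a ξ * g ξ t := by
  have hb : ∀ ξ, ∀ t ∈ Icc (0 : ℝ) 1, |a ξ * g ξ t| ≤ A * C := fun ξ t ht ↦ by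
    rw [abs_mul]; exact mul_le_mul (hab ξ) (hg ξ t ht) (abs_nonneg _) ((abs_nonneg _).trans (hab ξ))
  refine diagMeasurable_of_one (A * C) hb ?_
  have hfun : (fun ξ ↦ diagCalc e κ hκ (fun ξ t ↦ a ξ * g ξ t) (A * C) hb ξ (v ξ)) =
      fun ξ ↦ ((a ξ : ℝ) : 𝕜) • diagCalc e κ hκ g C hg ξ (v ξ) := by
    funext ξ
    refine (e ξ).ext_inner fun i ↦ ?_
    rw [inner_smul_right, inner_basis_diagCalc, inner_basis_diagCalc]
    push_cast
    ring
  rw [hfun]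
  exact (RCLike.continuous_ofReal.measurable.comp ha).stronglyMeasurable.smul (h C hg)

/-- Negation and constants. [folklore] -/
theorem DiagMeasurable.neg {g : X → ℝ → ℝ} (h : DiagMeasurable e κ hκ v g) {C : ℝ}
    (hg : ∀ ξ, ∀ t ∈ Icc (0 : ℝ) 1, |g ξ t| ≤ C) : DiagMeasurable e κ hκ v fun ξ t ↦ -g ξ t := by
  have h1 := h.mul_left (a := fun _ ↦ (-1 : ℝ)) measurable_const (A := 1) (fun _ ↦ by simp) hg
  exact h1.congr (fun ξ t _ ↦ by ring) (C' := C) (fun ξ t ht ↦ by rw [abs_neg]; exact hg ξ t ht)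

/-- The constant function `1` (i.e. the identity operator). [folklore] -/
theorem diagMeasurable_one (hv : StronglyMeasurable v) :
    DiagMeasurable e κ hκ v fun _ _ ↦ (1 : ℝ) := by
  refine diagMeasurable_of_one 1 (fun _ _ _ ↦ by simp) ?_
  have hfun : (fun ξ ↦ diagCalc e κ hκ (fun _ _ ↦ (1 : ℝ)) 1 (fun _ _ _ ↦ by simp) ξ (v ξ)) =
      v := by
    funext ξ
    refine (e ξ).ext_inner fun i ↦ ?_
    rw [inner_basis_diagCalc]
    push_cast
    ring
  rwa [hfun]

/-- **Dominated convergence**: pointwise bounded limits preserve measurability. [folklore] -/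
theorem DiagMeasurable.of_tendsto {gn : ℕ → X → ℝ → ℝ} {g : X → ℝ → ℝ} {C : ℝ}
    (hgn : ∀ n ξ, ∀ t ∈ Icc (0 : ℝ) 1, |gn n ξ t| ≤ C) (hg : ∀ ξ, ∀ t ∈ Icc (0 : ℝ) 1, |g ξ t| ≤ C)
    (hlim : ∀ ξ, ∀ t ∈ Icc (0 : ℝ) 1, Tendsto (fun n ↦ gn n ξ t) atTop (𝓝 (g ξ t)))
    (h : ∀ n, DiagMeasurable e κ hκ v (gn n)) : DiagMeasurable e κ hκ v g := by
  refine diagMeasurable_of_one C hg (stronglyMeasurable_of_tendsto (u := atTop)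
    (f := fun n ξ ↦ diagCalc e κ hκ (gn n) C (hgn n) ξ (v ξ)) (fun n ↦ h n C (hgn n)) ?_)
  rw [tendsto_pi_nhds]
  intro ξ
  refine tendsto_diag_of_tendsto (e := e ξ) (rn := fun n i ↦ ((gn n ξ (κ ξ i) : ℝ) : 𝕜))
    (fun i ↦ ?_) (v ξ)
  exact (RCLike.continuous_ofReal.tendsto _).comp (hlim ξ _ (hκ ξ i))

/-! #### Polynomials and continuous functions of the levels -/

/-- Powers of the family applied to `v` are measurable. [folklore] -/
theorem stronglyMeasurable_pow_apply (hK : StronglyMeasurable (diagFamily e κ hκ))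
    (hv : StronglyMeasurable v) (n : ℕ) :
    StronglyMeasurable fun ξ ↦ (diagFamily e κ hκ ξ ^ n) (v ξ) := by
  have hc : Continuous fun p : (H →L[𝕜] H) × H ↦ p.1 p.2 := isBoundedBilinearMap_apply.continuous
  have hp : StronglyMeasurable fun ξ ↦ diagFamily e κ hκ ξ ^ n :=
    (continuous_pow n).comp_stronglyMeasurable hK
  exact hc.comp_stronglyMeasurable (hp.prodMk hv)

/-- **Polynomials of the levels.** [cite: ReedSimonI1980, Thm. VII.2] -/
theorem diagMeasurable_polynomial (hK : StronglyMeasurable (diagFamily e κ hκ))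
    (hv : StronglyMeasurable v) (p : Polynomial ℝ) :
    DiagMeasurable e κ hκ v fun _ t ↦ p.eval t := by
  -- a bound for `p` on `[0, 1]`
  obtain ⟨Cp, hCp⟩ : ∃ Cp, ∀ t ∈ Icc (0 : ℝ) 1, |p.eval t| ≤ Cp := by
    have hc : ContinuousOn (fun t ↦ |p.eval t|) (Icc (0 : ℝ) 1) :=
      (continuous_abs.comp p.continuous).continuousOn
    obtain ⟨C, hC⟩ := isCompact_Icc.bddAbove_image hc
    exact ⟨C, fun t ht ↦ hC ⟨t, ht, rfl⟩⟩
  refine diagMeasurable_of_one Cp (fun _ ↦ hCp) ?_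
  have hfun : (fun ξ ↦ diagCalc e κ hκ (fun _ t ↦ p.eval t) Cp (fun _ ↦ hCp) ξ (v ξ)) =
      fun ξ ↦ ∑ k ∈ Finset.range (p.natDegree + 1),
        ((p.coeff k : ℝ) : 𝕜) • (diagFamily e κ hκ ξ ^ k) (v ξ) := by
    funext ξ
    exact diag_eval_eq_sum (norm_level_le_one κ hκ ξ) p _ (v ξ)
  rw [hfun]
  have hterm : ∀ k, StronglyMeasurable fun ξ ↦
      ((p.coeff k : ℝ) : 𝕜) • (diagFamily e κ hκ ξ ^ k) (v ξ) := fun k ↦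
    (stronglyMeasurable_pow_apply hK hv k).const_smul _
  exact Finset.stronglyMeasurable_fun_sum (Finset.range (p.natDegree + 1)) fun k _ ↦ hterm k

/-- **Continuous functions of the levels** (Weierstrass on `[0, 1]` + operator-norm convergence).
[cite: ReedSimonI1980, Thm. VII.1] -/
theorem diagMeasurable_continuous (hK : StronglyMeasurable (diagFamily e κ hκ))
    (hv : StronglyMeasurable v) {h : ℝ → ℝ} (hh : Continuous h) :
    DiagMeasurable e κ hκ v fun _ t ↦ h t := by
  obtain ⟨Ch, hCh⟩ : ∃ Ch, ∀ t ∈ Icc (0 : ℝ) 1, |h t| ≤ Ch := by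
    obtain ⟨C, hC⟩ := isCompact_Icc.bddAbove_image (continuous_abs.comp hh).continuousOn
    exact ⟨C, fun t ht ↦ hC ⟨t, ht, rfl⟩⟩
  -- polynomials `p_n` with `|p_n - h| < 1/(n+1)` on `[0,1]`
  have hp : ∀ n : ℕ, ∃ p : Polynomial ℝ, ∀ t ∈ Icc (0 : ℝ) 1, |p.eval t - h t| < 1 / (n + 1) :=
    fun n ↦ exists_polynomial_near_of_continuousOn 0 1 h hh.continuousOn _ (by positivity)
  choose p hp using hp
  have hpb : ∀ (n : ℕ) (ξ : X), ∀ t ∈ Icc (0 : ℝ) 1, |(p n).eval t| ≤ Ch + 1 := fun n ξ t ht ↦ by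
    have h1 := hp n t ht
    have h2 := hCh t ht
    have h3 : (1 : ℝ) / (n + 1) ≤ 1 := by
      rw [div_le_one (by positivity)]; linarith [n.cast_nonneg (α := ℝ)]
    calc |(p n).eval t| = |((p n).eval t - h t) + h t| := by ring_nf
      _ ≤ |(p n).eval t - h t| + |h t| := abs_add_le _ _
      _ ≤ Ch + 1 := by linarith
  have hCh' : ∀ ξ : X, ∀ t ∈ Icc (0 : ℝ) 1, |h t| ≤ Ch + 1 := fun _ t ht ↦ by linarith [hCh t ht]
  refine diagMeasurable_of_one (Ch + 1) hCh' (stronglyMeasurable_of_tendsto (u := atTop)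
    (f := fun n ξ ↦ diagCalc e κ hκ (fun _ t ↦ (p n).eval t) (Ch + 1) (hpb n) ξ (v ξ))
    (fun n ↦ diagMeasurable_polynomial hK hv (p n) _ _) ?_)
  rw [tendsto_pi_nhds]
  intro ξ
  rw [tendsto_iff_norm_sub_tendsto_zero]
  -- `‖diag(p_n ∘ κ) v - diag(h ∘ κ) v‖ ≤ ‖v‖/(n+1)`
  have hb : ∀ n : ℕ, ‖diagCalc e κ hκ (fun _ t ↦ (p n).eval t) (Ch + 1) (hpb n) ξ (v ξ) -
      diagCalc e κ hκ (fun _ t ↦ h t) (Ch + 1) hCh' ξ (v ξ)‖ ≤ 1 / (n + 1) * ‖v ξ‖ := by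
    intro n
    have hsub : diagCalc e κ hκ (fun _ t ↦ (p n).eval t) (Ch + 1) (hpb n) ξ (v ξ) -
        diagCalc e κ hκ (fun _ t ↦ h t) (Ch + 1) hCh' ξ (v ξ) =
        (diagCalc e κ hκ (fun _ t ↦ (p n).eval t) (Ch + 1) (hpb n) ξ -
          diagCalc e κ hκ (fun _ t ↦ h t) (Ch + 1) hCh' ξ) (v ξ) := rfl
    rw [hsub, diagCalc, diagCalc, diag_sub_diag]
    refine (le_opNorm _ _).trans (mul_le_mul_of_nonneg_right ?_ (norm_nonneg _))
    refine norm_diag_le (by positivity) fun i ↦ ?_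
    rw [← RCLike.ofReal_sub, RCLike.norm_ofReal]
    exact (hp n _ (hκ ξ i)).le
  have h0 : Tendsto (fun n : ℕ ↦ 1 / ((n : ℝ) + 1) * ‖v ξ‖) atTop (𝓝 0) := by
    have := tendsto_one_div_add_atTop_nhds_zero_nat.mul_const ‖v ξ‖
    simpa using this
  exact squeeze_zero (fun n ↦ norm_nonneg _) hb h0

/-! #### Indicators: closed level sets, then Dynkin twice -/

/-- **Measurable `ξ`-set times closed level set.** [folklore] -/
theorem diagMeasurable_indicator_prod_closed (hK : StronglyMeasurable (diagFamily e κ hκ))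
    (hv : StronglyMeasurable v) {A : Set X} (hA : MeasurableSet A) {B : Set ℝ} (hB : IsClosed B) :
    DiagMeasurable e κ hκ v fun ξ t ↦ (A ×ˢ B).indicator (fun _ ↦ (1 : ℝ)) (ξ, t) := by
  classical
  -- thickened indicators `θ_n → 1_B` pointwise (B closed), continuous, values in `[0,1]`
  have hδ : ∀ n : ℕ, (0 : ℝ) < 1 / (n + 1) := fun n ↦ by positivity
  set θ : ℕ → ℝ → ℝ := fun n t ↦ ((thickenedIndicator (hδ n) B t : NNReal) : ℝ) with hθ
  have hθc : ∀ n, Continuous (θ n) := fun n ↦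
    NNReal.continuous_coe.comp (thickenedIndicator (hδ n) B).continuous
  have hθb : ∀ n t, |θ n t| ≤ 1 := fun n t ↦ by
    rw [hθ]
    simp only [NNReal.abs_eq]
    exact_mod_cast thickenedIndicator_le_one (hδ n) B t
  have hθlim : ∀ t, Tendsto (fun n ↦ θ n t) atTop (𝓝 (B.indicator (fun _ ↦ (1 : ℝ)) t)) := by
    intro t
    have h := thickenedIndicator_tendsto_indicator_closure hδ
      tendsto_one_div_add_atTop_nhds_zero_nat B
    rw [tendsto_pi_nhds] at h
    have ht := (NNReal.continuous_coe.tendsto _).comp (h t)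
    rw [hB.closure_eq] at ht
    have hval : ((B.indicator (fun _ ↦ (1 : NNReal)) t : NNReal) : ℝ) =
        B.indicator (fun _ ↦ (1 : ℝ)) t := by
      by_cases htB : t ∈ B
      · rw [Set.indicator_of_mem htB, Set.indicator_of_mem htB, NNReal.coe_one]
      · rw [Set.indicator_of_notMem htB, Set.indicator_of_notMem htB, NNReal.coe_zero]
    rw [hval] at ht
    exact ht
  -- each `1_A(ξ) θ_n(t)` is measurable (continuous level function times measurable scalar)
  have hn : ∀ n, DiagMeasurable e κ hκ v fun ξ t ↦ A.indicator (fun _ ↦ (1 : ℝ)) ξ * θ n t :=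
      fun n ↦
    (diagMeasurable_continuous hK hv (hθc n)).mul_left (a := A.indicator fun _ ↦ (1 : ℝ))
      (measurable_const.indicator hA) (A := 1)
      (fun ξ ↦ by by_cases hξ : ξ ∈ A <;> simp [hξ]) (C := 1) (fun _ t _ ↦ hθb n t)
  refine DiagMeasurable.of_tendsto (C := 1) (fun n ξ t _ ↦ abs_indicator_mul_le (hθb n) ξ t)
    (fun ξ t _ ↦ ?_) (fun ξ t _ ↦ ?_) hn
  · rw [Set.indicator_apply]; split_ifs <;> simp
  · have h := (hθlim t).const_mul (A.indicator (fun _ ↦ (1 : ℝ)) ξ)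
    convert h using 2
    simp only [Set.indicator_apply, Set.mem_prod]
    split_ifs <;> simp_all

/-- Complements inside a measurable product set. [folklore] -/
theorem DiagMeasurable.compl_indicator (hv : StronglyMeasurable v) {S : Set (X × ℝ)}
    (h : DiagMeasurable e κ hκ v fun ξ t ↦ S.indicator (fun _ ↦ (1 : ℝ)) (ξ, t)) :
    DiagMeasurable e κ hκ v fun ξ t ↦ Sᶜ.indicator (fun _ ↦ (1 : ℝ)) (ξ, t) := by
  classical
  have h1 := (diagMeasurable_one (e := e) (κ := κ) (hκ := hκ) hv).add (h.neg (C := 1)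
    (fun ξ t _ ↦ abs_indicator_one_le S (ξ, t))) (C := 1) (C' := 1) (fun _ _ _ ↦ by simp)
    (fun ξ t _ ↦ by rw [abs_neg]; exact abs_indicator_one_le S (ξ, t))
  refine h1.congr (fun ξ t _ ↦ ?_) (C' := 1) (fun ξ t _ ↦ abs_indicator_one_le _ _)
  simp only [Set.indicator_apply, Set.mem_compl_iff]
  split_ifs <;> norm_num

/-- Countable disjoint unions. [folklore] -/
theorem DiagMeasurable.iUnion_indicator (hv : StronglyMeasurable v) {S : ℕ → Set (X × ℝ)}
    (hd : Pairwise (Function.onFun Disjoint S))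
    (h : ∀ n, DiagMeasurable e κ hκ v fun ξ t ↦ (S n).indicator (fun _ ↦ (1 : ℝ)) (ξ, t)) :
    DiagMeasurable e κ hκ v fun ξ t ↦ (⋃ n, S n).indicator (fun _ ↦ (1 : ℝ)) (ξ, t) := by
  classical
  -- partial unions
  have hfin : ∀ n, DiagMeasurable e κ hκ v fun ξ t ↦
      (⋃ k < n, S k).indicator (fun _ ↦ (1 : ℝ)) (ξ, t) := by
    intro n
    induction n with
    | zero =>
      refine (diagMeasurable_one (e := e) (κ := κ) (hκ := hκ) hv).mul_left (a := fun _ ↦ (0 : ℝ))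
        measurable_const (A := 0) (fun _ ↦ by simp) (C := 1) (fun _ _ _ ↦ by simp) |>.congr
        (fun ξ t _ ↦ ?_) (C' := 1) (fun ξ t _ ↦ abs_indicator_one_le _ _)
      simp
    | succ n ih =>
      have hunion : (⋃ k < n + 1, S k) = (⋃ k < n, S k) ∪ S n := by
        ext z; simp only [Set.mem_iUnion, Set.mem_union, Nat.lt_succ_iff]
        constructor
        · rintro ⟨k, hk, hz⟩
          rcases hk.lt_or_eq with hk | rfl
          · exact Or.inl ⟨k, hk, hz⟩
          · exact Or.inr hz
        · rintro (⟨k, hk, hz⟩ | hz)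
          · exact ⟨k, hk.le, hz⟩
          · exact ⟨n, le_rfl, hz⟩
      have hdisj : Disjoint (⋃ k < n, S k) (S n) := by
        rw [Set.disjoint_iUnion_left]
        intro k
        rw [Set.disjoint_iUnion_left]
        intro hk
        exact hd hk.ne
      refine (ih.add (h n) (C := 1) (C' := 1) (fun ξ t _ ↦ abs_indicator_one_le _ _)
        (fun ξ t _ ↦ abs_indicator_one_le _ _)).congr (fun ξ t _ ↦ ?_) (C' := 1)
        (fun ξ t _ ↦ abs_indicator_one_le _ _)
      rw [hunion, Set.indicator_union_of_disjoint hdisj]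
  refine DiagMeasurable.of_tendsto (C := 1) (fun n ξ t _ ↦ abs_indicator_one_le _ _)
    (fun ξ t _ ↦ abs_indicator_one_le _ _) (fun ξ t _ ↦ ?_) hfin
  -- pointwise convergence of the partial indicators
  by_cases hz : (ξ, t) ∈ ⋃ n, S n
  · obtain ⟨n₀, hn₀⟩ := Set.mem_iUnion.1 hz
    rw [Set.indicator_of_mem hz]
    refine tendsto_atTop_of_eventually_const (i₀ := n₀ + 1) fun n hn ↦ ?_
    rw [Set.indicator_of_mem]
    exact Set.mem_biUnion (show n₀ ∈ {k | k < n} from lt_of_lt_of_le (Nat.lt_succ_self n₀) hn) hn₀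
  · rw [Set.indicator_of_notMem hz]
    refine tendsto_const_nhds.congr fun n ↦ ?_
    rw [Set.indicator_of_notMem]
    intro hz'
    apply hz
    obtain ⟨k, -, hk⟩ := Set.mem_iUnion₂.1 hz'
    exact Set.mem_iUnion.2 ⟨k, hk⟩

/-- **Measurable `ξ`-set times Borel level set.** [folklore] -/
theorem diagMeasurable_indicator_prod (hK : StronglyMeasurable (diagFamily e κ hκ))
    (hv : StronglyMeasurable v) {A : Set X} (hA : MeasurableSet A) {B : Set ℝ}
    (hB : MeasurableSet B) :
    DiagMeasurable e κ hκ v fun ξ t ↦ (A ×ˢ B).indicator (fun _ ↦ (1 : ℝ)) (ξ, t) := by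
  classical
  -- Dynkin in the level variable
  refine MeasurableSpace.induction_on_inter (C := fun B _ ↦
      DiagMeasurable e κ hκ v fun ξ t ↦ (A ×ˢ B).indicator (fun _ ↦ (1 : ℝ)) (ξ, t))
    (borel_eq_generateFrom_isClosed (α := ℝ)) isPiSystem_isClosed ?_ ?_ ?_ ?_ B hB
  · simpa using diagMeasurable_indicator_prod_closed hK hv hA isClosed_empty
  · exact fun B hB ↦ diagMeasurable_indicator_prod_closed hK hv hA hB
  · intro B hBm hBd
    -- `A × Bᶜ = (A × univ) \ (A × B)`, as indicators: `1_{A×univ} - 1_{A×B}`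
    have hu := diagMeasurable_indicator_prod_closed hK hv hA isClosed_univ
    have h1 := hu.add (hBd.neg (C := 1) (fun ξ t _ ↦ abs_indicator_one_le _ _)) (C := 1) (C' := 1)
      (fun ξ t _ ↦ abs_indicator_one_le _ _)
      (fun ξ t _ ↦ by rw [abs_neg]; exact abs_indicator_one_le _ _)
    refine h1.congr (fun ξ t _ ↦ ?_) (C' := 1) (fun ξ t _ ↦ abs_indicator_one_le _ _)
    simp only [Set.indicator_apply, Set.mem_prod, Set.mem_univ, Set.mem_compl_iff, and_true]
    split_ifs <;> simp_all
  · intro f hfd hfm hf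
    have hS : (A ×ˢ ⋃ n, f n) = ⋃ n, A ×ˢ f n := Set.prod_iUnion
    rw [hS]
    refine DiagMeasurable.iUnion_indicator hv (fun i j hij ↦ ?_) hf
    exact Set.disjoint_prod.2 (Or.inr (hfd hij))

/-- **Measurability of the spectral calculus along a measurable eigen-family**: for every
measurable `S ⊆ X × ℝ` and strongly measurable `v`, `ξ ↦ 1_S(ξ, K ξ) v ξ` is strongly measurable.
[cite: ReedSimonI1980, Thm. VII.2] -/
theorem diagMeasurable_indicator (hK : StronglyMeasurable (diagFamily e κ hκ))
    (hv : StronglyMeasurable v) {S : Set (X × ℝ)} (hS : MeasurableSet S) :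
    DiagMeasurable e κ hκ v fun ξ t ↦ S.indicator (fun _ ↦ (1 : ℝ)) (ξ, t) := by
  refine MeasurableSpace.induction_on_inter (C := fun S _ ↦
      DiagMeasurable e κ hκ v fun ξ t ↦ S.indicator (fun _ ↦ (1 : ℝ)) (ξ, t))
    generateFrom_prod.symm isPiSystem_prod ?_ ?_ ?_ ?_ S hS
  · simpa using diagMeasurable_indicator_prod hK hv MeasurableSet.empty MeasurableSet.empty
  · rintro _ ⟨A, hA, B, hB, rfl⟩
    exact diagMeasurable_indicator_prod hK hv hA hB
  · exact fun S _ hS ↦ hS.compl_indicator hv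
  · exact fun f hfd _ hf ↦ DiagMeasurable.iUnion_indicator hv hfd hf

/-- The same in the `if … then 1 else 0` form of `specProj`. [folklore] -/
theorem stronglyMeasurable_diagIndicator (hK : StronglyMeasurable (diagFamily e κ hκ))
    (hv : StronglyMeasurable v) {S : Set (X × ℝ)} (hS : MeasurableSet S)
    [∀ ξ i, Decidable ((ξ, κ ξ i) ∈ S)] :
    StronglyMeasurable fun ξ ↦ basisDiag (e ξ)
      (fun i ↦ if (ξ, κ ξ i) ∈ S then (1 : 𝕜) else 0) 1 (fun i ↦ by split_ifs <;> simp) (v ξ) := by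
  classical
  have h := diagMeasurable_indicator hK hv hS 1 (fun ξ t _ ↦ abs_indicator_one_le _ _)
  have hfun : (fun ξ ↦ basisDiag (e ξ) (fun i ↦ if (ξ, κ ξ i) ∈ S then (1 : 𝕜) else 0) 1
      (fun i ↦ by split_ifs <;> simp) (v ξ)) = fun ξ ↦
      diagCalc e κ hκ (fun ξ t ↦ S.indicator (fun _ ↦ (1 : ℝ)) (ξ, t)) 1
        (fun ξ t _ ↦ abs_indicator_one_le _ _) ξ (v ξ) := by
    funext ξ
    rw [diagCalc]
    exact diag_congr (fun i ↦ by rw [Set.indicator_apply]; split_ifs <;> simp) _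
  rw [hfun]
  exact h

end Measurable

end Literature.Analysis.OperatorTheory
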